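import Literature.MathematicalPhysics.QuantumFieldTheory.Balaban1983to89.B11Eq96CommutatorCurrent

/-!
# `Balaban1983to89.B11Eq63V0GroupCurrent` — T. Bałaban, *The variational problem and background fields in renormalization group method for lattice gauge theories*, Commun. Math. Phys. **102** (1985) 277–309 [Balaban1985Variational]: (63) p. 287 with (27), (26)/(30) p. 282 and (39) p. 284, for (90)–(96) pp. 291–292 — THE PAIRING CERTIFICATE of the commutator-group current and THE V₀-GROUP CURRENT `curV0 := curV0prime + curComm` ON THE (115) CARRIERS: `⟨curV0(Y), δ⟩ = (d/dt) V₀(Y + tδ)|_{t=0}` for r08's WHOLE remainder `V₀` of (26) — «W for the V₀ term of (80)», read at `A`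

statement-level skeleton of published theorems with citation tags; proofs where landed; nothing here is a claim about the Yang–Mills mass gap

PDF held: `paper:balaban1985-cmp102-variational-background` (journal page = PDF page + 276); pp. 282, 284, 287, 290–292 read from the `lit read` text
layer; displays as transcribed in `B11Eq26ActionExpansion` ((26), (29)–(30)), `B11Eq27Current` ((27)), `B11Eq63FunctionalDerivative` ((63)),
`B11Eq37NormBound` ((39)), `B11Eq85FirstDerivative`/`B11Eq93Commutator` ((90)–(96)).

CITATION HEADER (lean-in-tree rule 2026-08-18).  WHAT IS REPRODUCED: (63) p. 287 *«⟨(δ/δA′)D(A′), δA′⟩ = (d/dτ)D(A′ + τδA′)|_{τ=0}»* for the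
V₀-part of the function `V(A′)` of (80) (p. 290: its first three terms involve `D`, `H`, `𝔇`; the V₀-term splits by (39) into the V′₀-group (90)
and the commutator group (91)–(96)), READ AT `A`: the two currents of `B11Eq90V0primeCurrent` (V′₀) and `B11Eq96CommutatorCurrent` (commutator)
SUM to the functional derivative of r08's `B11Eq26ActionExpansion.V0` = `V₀(A)` of (26) through (30) `V₀(A) = Σ_p η^d V₀(A, ∂p)` (`eq30a`) and
(39) `V₀(A, ∂p) = ½ i tr((DA)(p)Σ[A′,A′]) + V′₀(A, ∂p)` (`B11Eq90V0primeBond.V0primeP`).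

WHAT IS DEFINED AND PROVED (sorry-free; axioms `propext` / `Classical.choice` / `Quot.sound`; one def `curV0` with body; no `Prop`-valued definition,
no new named fact).
§6 **`bondPair_curComm`** — (63) with (27) for the commutator group: `bondPair η d τ (curComm Y) δ = (d/dt) Σ_{p} η^d·term39(Y + tδ, ∂p)|₀`,
   given the dualising identity `τ(ρ(ℓ)X) = ℓ X` (`B11Eq92CommutatorFunctional.dTerm39Bond_eq_zero_of_not_mem_st` for the «Σ_{p∈st(b)}»).
§7 `quadAnalytic_add` ([folklore]: `B13Contraction113.QuadAnalytic` is additive in the map, constants add); **`curV0 ρ τ U₀ := curV0prime + curComm`**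
   (`Space115 L η lev₀ lev₁ Dc → NegSize L η lev₀ 3 𝔸`, any `Dc`); **`bondPair_curV0`** — `⟨curV0(Y), δ⟩ = (d/dt) V₀(Y + tδ)|_{t=0}` with
   `V₀ = B11Eq26ActionExpansion.V0 Tsh (Ucur U₀) η d τ` (tracial `τ`, `d ≧ 4` as in `eq30a`): THE CURRENT IS THE FUNCTIONAL DERIVATIVE OF THE
   WHOLE THIRD-ORDER REMAINDER of the action expansion (26) at the (115) carrier; **`quadAnalytic_curV0`** — the `Regime.quad` slot for the
   V₀-group at radius `1/16`, constant `C_{V′₀} + C_comm` (`quadAnalytic_add` of the two groups' slots).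

HONEST SCOPE — what is NOT claimed.  (i) READ AT `A`: print's W₄ + W₅ are these currents composed with the Sect. C map (47) `A = A′ − HD(A′)` plus the
`𝔇*(A′)H*` term of (90) and the `HD(A′)`-insertion terms of p. 292 — NOT touched; the groups (85)–(89) (through `D`, `H`, `𝔇`) are NOT touched; so this
is NOT (L3) `W`.  (ii) `ρ` a letter with its dualising display (constructed in `B11Eq98V0primeCurrentSlots` §7).  (iii) DIVERGENCE D-pv27.4
inherited.  (iv) NOT summit progress (cell pub-balaban: NE9 NOT PRINTED / NOT PROVED; spine PROVED 0/9).  Unit `b2b-balaban-t4-ne9-formalise-leaf-05`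
(NE9 crux-team leaf prover, gen 64).  Imports `B11Eq96CommutatorCurrent` ONLY.
-/

noncomputable section

open NormedSpace Complex Metric Set Finset Filter Topology

namespace Literature.MathematicalPhysics.QuantumFieldTheory.Balaban1983to89.B11Eq63V0GroupCurrent

open Literature.MathematicalPhysics.QuantumFieldTheory.Balaban1983to89.Beta.TransportVertices
open Literature.MathematicalPhysics.QuantumFieldTheory.Balaban1983to89.B9Eq37Insertion
open Literature.MathematicalPhysics.QuantumFieldTheory.Balaban1983to89.B9Eq39Adjoint
open Literature.MathematicalPhysics.QuantumFieldTheory.Balaban1983to89.B11Eq26ActionExpansion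
open Literature.MathematicalPhysics.QuantumFieldTheory.Balaban1983to89.B11Eq90V0Derivative
open Literature.MathematicalPhysics.QuantumFieldTheory.Balaban1983to89.B11Eq90StB
open Literature.MathematicalPhysics.QuantumFieldTheory.Balaban1983to89.B11Eq90V0primeBond
open Literature.MathematicalPhysics.QuantumFieldTheory.Balaban1983to89.B11Eq94CommutatorBond
open Literature.MathematicalPhysics.QuantumFieldTheory.Balaban1983to89.B11Eq92CommutatorFunctional
open Literature.MathematicalPhysics.QuantumFieldTheory.Balaban1983to89.B11Eq90V0primeCurrent
open Literature.MathematicalPhysics.QuantumFieldTheory.Balaban1983to89.B11Eq98V0primeCurrentSlots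
open Literature.MathematicalPhysics.QuantumFieldTheory.Balaban1983to89.B11Eq96CommutatorCurrent
open B9SectCLatticeCarrier (Bond) open B4Sect5Torus (TSite) open B9Eq33CovDerivVector (shiftEquiv)
open B11Eq115Space
open B11Eq111FrakG (nabla115 nabla115_apply)

variable {𝔸 : Type*} [NormedRing 𝔸] [NormedAlgebra ℂ 𝔸] [CompleteSpace 𝔸]

/-! ## §6 The pairing certificate (63)/(27) for the commutator group -/

section Pairing

variable {d : ℕ} {Pd : Fin d → ℕ} {L η : ℝ} {lev₀ : Bond d Pd → ℕ} {κ' : Type*} {lev₁ : κ' → ℕ}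
  {Dc : (Bond d Pd → 𝔸) →ₗ[ℂ] (κ' → 𝔸)}

omit [CompleteSpace 𝔸] in
/-- **(63) FOR THE (39)-PART OF `V₀`, THROUGH (27)**: `⟨curComm(Y), δ⟩ = (d/dt) Σ_p η^d·term39(Y + tδ, ∂p)|_{t=0}` for every direction `δ`, given the
dualising identity `τ(ρ(ℓ)X) = ℓ X` (the proof of `B11Eq98V0primeCurrentSlots.bondPair_curV0prime` with `term39` for `V′₀`).
[cite: Balaban1985Variational, (63) p.287, (27) p.282, (91) p.292] -/
theorem bondPair_curComm [Fact (0 < L)] [Fact (0 < η)] [Fintype κ'] (ρ : (𝔸 →L[ℂ] ℂ) →L[ℂ] 𝔸) (τ : 𝔸 →L[ℂ] ℂ)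
    (hρ : ∀ (ℓ : 𝔸 →L[ℂ] ℂ) (X : 𝔸), τ (ρ ℓ * X) = ℓ X)
    (U₀ : Bond d Pd → 𝔸ˣ) (Y : Space115 L η lev₀ lev₁ Dc) (δ : Bond d Pd → 𝔸) :
    bondPair η d (τ : 𝔸 →ₗ[ℂ] ℂ) (curL (NegSup.equiv (levWeight L η lev₀ 3) 𝔸 (curComm (lev₁ := lev₁) (Dc := Dc) ρ τ U₀ Y)))
        (curL δ)
      = deriv (fun t : ℂ => ∑ q ∈ posPlaq (TSite d Pd) (Fin d),
          (η : ℂ) ^ d * term39 Tsh (Ucur U₀) η (τ : 𝔸 →ₗ[ℂ] ℂ)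
            (curL (JetSup.equiv (levWeight L η lev₀ 1) (levWeight L η lev₁ 2) Dc Y) + t • curL δ) q.2.1 q.2.2 q.1) 0 := by
  set A := curL (JetSup.equiv (levWeight L η lev₀ 1) (levWeight L η lev₁ 2) Dc Y) with hA
  set D := curL (𝔸 := 𝔸) δ with hD
  have hline : ∀ q : TSite d Pd × Fin d × Fin d, Differentiable ℂ (fun t : ℂ =>
      term39 Tsh (Ucur U₀) η (τ : 𝔸 →ₗ[ℂ] ℂ) (A + t • D) q.2.1 q.2.2 q.1) := fun q =>
    ((contDiff_term39 Tsh (Ucur U₀) (n := 1) η τ q.2.1 q.2.2 q.1).differentiable (by norm_num)).comp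
      (by fun_prop)
  have hq : ∀ q ∈ posPlaq (TSite d Pd) (Fin d), HasDerivAt
      (fun t : ℂ => (η : ℂ) ^ d * term39 Tsh (Ucur U₀) η (τ : 𝔸 →ₗ[ℂ] ℂ) (A + t • D) q.2.1 q.2.2 q.1)
      ((η : ℂ) ^ d * fderiv ℂ (fun B => term39 Tsh (Ucur U₀) η (τ : 𝔸 →ₗ[ℂ] ℂ) B q.2.1 q.2.2 q.1) A D) 0 := by
    intro q _
    have h := ((hline q) 0).hasDerivAt.const_mul ((η : ℂ) ^ d)
    rwa [deriv_line_eq_fderiv (((contDiff_term39 Tsh (Ucur U₀) (n := 1) η τ q.2.1 q.2.2 q.1).differentiable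
      (by norm_num)) A)] at h
  rw [(HasDerivAt.fun_sum hq).deriv]
  have hexp : ∀ q : TSite d Pd × Fin d × Fin d,
      fderiv ℂ (fun B => term39 Tsh (Ucur U₀) η (τ : 𝔸 →ₗ[ℂ] ℂ) B q.2.1 q.2.2 q.1) A D
        = ∑ b : Bond d Pd, dTerm39Bond Tsh (Ucur U₀) η τ A q b.2 b.1 (δ b) := by
    intro q
    rw [hD, curL_eq_sum_bondDelta, map_sum]
    refine Finset.sum_congr rfl fun b _ => ?_
    rw [dTerm39Bond, ContinuousLinearMap.comp_apply, δL_apply]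
  simp_rw [hexp]
  rw [← Finset.mul_sum, Finset.sum_comm, bondPair, Fintype.sum_prod_type]
  congr 1
  refine Finset.sum_congr rfl fun x _ => Finset.sum_congr rfl fun μ _ => ?_
  have hzero : ∀ q ∈ posPlaq (TSite d Pd) (Fin d), q ∉ st Tsh μ x →
      dTerm39Bond Tsh (Ucur U₀) η τ A q μ x (δ (x, μ)) = 0 := fun q hq hqs => by
    rw [dTerm39Bond_eq_zero_of_not_mem_st Tsh (Ucur U₀) η τ A hq hqs, zero_apply]
  rw [← Finset.sum_subset (st_subset_posPlaq Tsh μ x) hzero]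
  simp only [curL_apply, curComm_apply, Finset.sum_mul, map_sum, ContinuousLinearMap.coe_coe, hρ]
  rfl

end Pairing

/-! ## §7 «W for the V₀ term of (80)»: the V₀-GROUP CURRENT `curV0prime + curComm` -/

section V0Group

/-- `QuadAnalytic` is additive in the map ([folklore] bookkeeping on `B13Contraction113.QuadAnalytic`).
[cite: Balaban1985Variational, (98) p.293] -/
theorem quadAnalytic_add {𝒴 𝒵 : Type*} [NormedAddCommGroup 𝒴] [NormedSpace ℂ 𝒴] [NormedAddCommGroup 𝒵] [NormedSpace ℂ 𝒵]
    {W₁ W₂ : 𝒴 → 𝒵} {C₁ C₂ R : ℝ} (h₁ : B13Contraction113.QuadAnalytic W₁ C₁ R)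
    (h₂ : B13Contraction113.QuadAnalytic W₂ C₂ R) :
    B13Contraction113.QuadAnalytic (fun Y => W₁ Y + W₂ Y) (C₁ + C₂) R where
  quad Y hY := (norm_add_le _ _).trans (by rw [add_mul]; exact add_le_add (h₁.quad Y hY) (h₂.quad Y hY))
  lineAnalytic P Q := (h₁.lineAnalytic P Q).add (h₂.lineAnalytic P Q)

variable {d : ℕ} {Pd : Fin d → ℕ} {L η : ℝ} [Fact (0 < L)] [Fact (0 < η)] {lev₀ : Bond d Pd → ℕ}
  {κ' : Type*} [Fintype κ'] {lev₁ : κ' → ℕ} {Dc : (Bond d Pd → 𝔸) →ₗ[ℂ] (κ' → 𝔸)}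

/-- **THE V₀-GROUP CURRENT** `curV0 := curV0prime + curComm` — the functional derivative (63) of the WHOLE remainder `V₀ = Σ_p η^d V₀(A, ∂p)` of
(26) (by (39): `V₀(A, ∂p) = ½ i tr((DA)(p)Σ[A′,A′]) + V′₀(A, ∂p)`), on the (115) carriers; «W for the V₀ term of (80)» read at `A`.
[cite: Balaban1985Variational, (39) p.284, (80) p.290, (90)-(96) pp.291-292] -/
def curV0 (ρ : (𝔸 →L[ℂ] ℂ) →L[ℂ] 𝔸) (τ : 𝔸 →L[ℂ] ℂ) (U₀ : Bond d Pd → 𝔸ˣ) (Y : Space115 L η lev₀ lev₁ Dc) :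
    NegSize L η lev₀ 3 𝔸 :=
  curV0prime (lev₁ := lev₁) (Dc := Dc) ρ τ U₀ Y + curComm (lev₁ := lev₁) (Dc := Dc) ρ τ U₀ Y

/-- **(63) FOR THE WHOLE `V₀`**: `⟨curV0(Y), δ⟩ = (d/dt) V₀(Y + tδ)|_{t=0}` with `V₀ = B11Eq26ActionExpansion.V0` of (26) (tracial `τ`, `η ≠ 0`, `d ≧ 4`
as in (30) `eq30a`), given the dualising identity. [cite: Balaban1985Variational, (63) p.287, (26) p.282, (30) p.282] -/
theorem bondPair_curV0 (ρ : (𝔸 →L[ℂ] ℂ) →L[ℂ] 𝔸) (τ : 𝔸 →L[ℂ] ℂ)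
    (hρ : ∀ (ℓ : 𝔸 →L[ℂ] ℂ) (X : 𝔸), τ (ρ ℓ * X) = ℓ X) (hτ : ∀ a b : 𝔸, τ (a * b) = τ (b * a)) (hd : 4 ≤ d)
    (U₀ : Bond d Pd → 𝔸ˣ) (Y : Space115 L η lev₀ lev₁ Dc) (δ : Bond d Pd → 𝔸) :
    bondPair η d (τ : 𝔸 →ₗ[ℂ] ℂ) (curL (NegSup.equiv (levWeight L η lev₀ 3) 𝔸 (curV0 (lev₁ := lev₁) (Dc := Dc) ρ τ U₀ Y))) (curL δ)
      = deriv (fun t : ℂ => V0 Tsh (Ucur U₀) η d (τ : 𝔸 →ₗ[ℂ] ℂ)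
          (curL (JetSup.equiv (levWeight L η lev₀ 1) (levWeight L η lev₁ 2) Dc Y) + t • curL δ)) 0 := by
  have hη : (η : ℝ) ≠ 0 := (Fact.out : 0 < η).ne'
  set A := curL (JetSup.equiv (levWeight L η lev₀ 1) (levWeight L η lev₁ 2) Dc Y) with hA
  set D := curL (𝔸 := 𝔸) δ with hD
  -- (30) with (39): V₀ = Σ η^d V′₀ + Σ η^d term39
  have e30 : (fun t : ℂ => V0 Tsh (Ucur U₀) η d (τ : 𝔸 →ₗ[ℂ] ℂ) (A + t • D))
      = fun t => (∑ q ∈ posPlaq (TSite d Pd) (Fin d), (η : ℂ) ^ d * V0primeP Tsh (Ucur U₀) η (τ : 𝔸 →ₗ[ℂ] ℂ) (A + t • D) q.2.1 q.2.2 q.1)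
          + ∑ q ∈ posPlaq (TSite d Pd) (Fin d), (η : ℂ) ^ d * term39 Tsh (Ucur U₀) η (τ : 𝔸 →ₗ[ℂ] ℂ) (A + t • D) q.2.1 q.2.2 q.1 := by
    funext t
    rw [eq30a Tsh (Ucur U₀) (τ : 𝔸 →ₗ[ℂ] ℂ) hτ η hη hd, ← Finset.sum_add_distrib]
    refine Finset.sum_congr rfl fun q _ => ?_
    rw [V0primeP]; ring
  have h1 : Differentiable ℂ (fun t : ℂ => ∑ q ∈ posPlaq (TSite d Pd) (Fin d),
      (η : ℂ) ^ d * V0primeP Tsh (Ucur U₀) η (τ : 𝔸 →ₗ[ℂ] ℂ) (A + t • D) q.2.1 q.2.2 q.1) := by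
    refine Differentiable.fun_sum fun q _ => (Differentiable.const_mul ?_ _)
    exact ((contDiff_V0primeP Tsh (Ucur U₀) (n := 1) η τ q.2.1 q.2.2 q.1).differentiable (by norm_num)).comp (by fun_prop)
  have h2 : Differentiable ℂ (fun t : ℂ => ∑ q ∈ posPlaq (TSite d Pd) (Fin d),
      (η : ℂ) ^ d * term39 Tsh (Ucur U₀) η (τ : 𝔸 →ₗ[ℂ] ℂ) (A + t • D) q.2.1 q.2.2 q.1) := by
    refine Differentiable.fun_sum fun q _ => (Differentiable.const_mul ?_ _)
    exact ((contDiff_term39 Tsh (Ucur U₀) (n := 1) η τ q.2.1 q.2.2 q.1).differentiable (by norm_num)).comp (by fun_prop)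
  rw [e30, ((h1 0).hasDerivAt.fun_add (h2 0).hasDerivAt).deriv,
    ← bondPair_curV0prime (lev₁ := lev₁) (Dc := Dc) ρ τ hρ U₀ Y δ, ← bondPair_curComm (lev₁ := lev₁) (Dc := Dc) ρ τ hρ U₀ Y δ]
  simp only [curV0, bondPair, map_add, NegSup.equiv_add, curL_apply, Pi.add_apply, add_mul, Finset.sum_add_distrib, mul_add, hD]

/-- **THE `Regime.quad` SLOT FOR «W FOR THE V₀ TERM OF (80)»** (read at `A`): under the hypotheses of `quadAnalytic_curV0prime` (V′₀-group: unitary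
background, tracial `*`-trace, (38)/(31) trace slots, `K`, `Λ`) and of `quadAnalytic_curComm` (commutator group: the three level-geometry displays),
`QuadAnalytic (curV0 ρ τ U₀) (C_{V′₀} + C_comm) (1/16)` at `Dc := nabla115 η U₀`. [cite: Balaban1985Variational, (98) p.293, (119)-(120) p.295] -/
theorem quadAnalytic_curV0 {lev₁ : Bond d Pd × Fin d → ℕ} [NormOneClass 𝔸] [StarRing 𝔸] [StarModule ℂ 𝔸]
    (ρ : (𝔸 →L[ℂ] ℂ) →L[ℂ] 𝔸) (τ : 𝔸 →L[ℂ] ℂ) (U₀ : Bond d Pd → 𝔸ˣ)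
    (hU : ∀ b, (((U₀ b)⁻¹ : 𝔸ˣ) : 𝔸) = star (U₀ b : 𝔸))
    (hUn : ∀ b, ‖(U₀ b : 𝔸)‖ ≤ 1 ∧ ‖(((U₀ b)⁻¹ : 𝔸ˣ) : 𝔸)‖ ≤ 1)
    (hτ : ∀ a b : 𝔸, τ (a * b) = τ (b * a)) (hτs : ∀ a : 𝔸, τ (star a) = starRingEnd ℂ (τ a))
    (hL : 1 ≤ L) {K Λ : ℝ} (hK : 0 ≤ K) (hΛ1 : 1 ≤ Λ)
    (hΛ : ∀ q ∈ posPlaq (TSite d Pd) (Fin d), ∀ (μ₀ : Fin d) (x₀ : TSite d Pd), q ∈ st Tsh μ₀ x₀ →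
      levWeight L η lev₀ 1 (x₀, μ₀) ≤ Λ * plaqWeight Tsh (levWeight L η lev₀ 1) q)
    (hΛa : ∀ (x₀ : TSite d Pd) (μ₀ ν : Fin d) (y : TSite d Pd), (y = x₀ ∨ y = (Tsh ν).symm x₀) →
      levWeight L η lev₀ 1 (x₀, μ₀) ≤ Λ * levWeight L η lev₀ 1 (y, μ₀) ∧
        levWeight L η lev₀ 1 (x₀, μ₀) ≤ Λ * levWeight L η lev₀ 1 (y, ν))
    (hΛ' : ∀ (x₀ : TSite d Pd) (μ₀ ν : Fin d) (y : TSite d Pd), (y = x₀ ∨ y = (Tsh ν).symm x₀) →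
      ∀ κ κ'' : Fin d, (κ = μ₀ ∨ κ = ν) → (κ'' = μ₀ ∨ κ'' = ν) →
        levWeight L η lev₀ 1 (x₀, μ₀) ^ 2 ≤ Λ ^ 2 * levWeight L η lev₁ 2 ((y, κ), κ''))
    (hRe1 : ∀ q ∈ posPlaq (TSite d Pd) (Fin d), ∀ Z : 𝔸,
      ‖(τ : 𝔸 →ₗ[ℂ] ℂ) (Z * (reC (plaqU Tsh (Ucur U₀) q.2.1 q.2.2 q.1) - 1))‖
        ≤ ‖Z‖ * (η ^ 2 * (K / plaqWeight Tsh (levWeight L η lev₀ 1) q ^ 2)))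
    (hIm : ∀ q ∈ posPlaq (TSite d Pd) (Fin d), ∀ Z : 𝔸,
      ‖(τ : 𝔸 →ₗ[ℂ] ℂ) (Z * (((η : ℂ) ^ 2)⁻¹ • imC (plaqU Tsh (Ucur U₀) q.2.1 q.2.2 q.1)))‖
        ≤ ‖Z‖ * (K / plaqWeight Tsh (levWeight L η lev₀ 1) q ^ 2))
    (hW : ∀ q ∈ posPlaq (TSite d Pd) (Fin d), ∀ Z : 𝔸,
      ‖(τ : 𝔸 →ₗ[ℂ] ℂ) (Z * (plaqU Tsh (Ucur U₀) q.2.1 q.2.2 q.1 : 𝔸))‖ ≤ ‖Z‖)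
    (hW' : ∀ q ∈ posPlaq (TSite d Pd) (Fin d), ∀ Z : 𝔸,
      ‖(τ : 𝔸 →ₗ[ℂ] ℂ) (Z * (((plaqU Tsh (Ucur U₀) q.2.1 q.2.2 q.1)⁻¹ : 𝔸ˣ) : 𝔸))‖ ≤ ‖Z‖) :
    B13Contraction113.QuadAnalytic (curV0 (L := L) (η := η) (lev₀ := lev₀) (lev₁ := lev₁) (Dc := nabla115 η U₀) ρ τ U₀)
      (1024 * ((d - 1 : ℕ) : ℝ) * Λ ^ 3 * ‖ρ‖ * (K + 1 / 16)
        + ((d - 1 : ℕ) : ℝ) * Λ ^ 3 * (136 + 2 * Λ) * ‖ρ‖ * ‖τ‖) (1 / 16) :=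
  quadAnalytic_add
    (quadAnalytic_curV0prime (lev₁ := lev₁) (Dc := nabla115 η U₀) ρ τ U₀ hU hUn hτ hτs hL hK (zero_le_one.trans hΛ1) hΛ hRe1 hIm hW hW')
    (quadAnalytic_curComm (lev₁ := lev₁) ρ τ U₀ hUn hτ hL hΛ1 hΛ hΛa hΛ' (1 / 16))

end V0Group

end Literature.MathematicalPhysics.QuantumFieldTheory.Balaban1983to89.B11Eq63V0GroupCurrent

end
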